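import Summits.AtomisticToContinuum.Crystallization.Theorems.ChartedZeroExcessLayeredLatticeLiouvilleUD

/-!
# Zero-excess layered lattice Liouville — part UE (lens-2 g45, node «CalmCollar» beneath [T] `TameWindowPG`):
# the special/generic cut of the HOT-STAR EXCLUSION by ISOLATION — `[T] ⟺ [I_w] CalmCollarWindowPG ∧ [T_cl] CloudTameWindowPG` (PROVED),
# the special side fed by the LOCAL, registration-free statement [I] `CalmCollarPG` («a calm collar forces a tame centre», `[I] ⇒ [I_w]` PROVED)

Line `_16XH19(_tol)` of statement 26636, (M)-side, after parts UC/UD: (M) ⟸ Gehring-leaf ∧ [T] ∧ [KS] ∧ [W] ∧ [CC°_W], every seam proved.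
Of the open pieces two are NEW and IDEA-NAMED only: [T] `TameWindowPG ϑ` (no `ϑ`-hot star in near-flat fat GSC door windows, part UC) and
[W] (part UD).  This file cuts [T], the older of the two, by the lens's dichotomy applied to the GEOMETRY OF THE HOT SET one step out from the star.

(α) WHY [T] CARRIES CONTENT THAT NO MEAN-SQUARE ARGUMENT REACHES.  [C] `RigidCaccioppoliPG` (part UA) is a weak reverse Hölder inequality with
constants FIXED by `(δ, a, Cg)`; near a single `ϑ`-hot star in an `η`-flat environment its left side on `B(x,r)`, `r = O(1)`, is `≥ ϑ²/#B` while the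
right side is `≲ b·(#B)^{-1/d}·ϑ² + b·A·η`, so for `η` small [C] itself forbids isolated hot stars (part UC, strictness witness of [C_T]).  A one-scale
e⋆-GSC exchange (Evans–Giusti competitor, hole filling) yields only the Caccioppoli inequality, i.e. Morrey decay with a tiny exponent — it cannot
see one `O(1)` star inside a window of misfit mass `η·R³`.  Excluding a hot star needs either full ε-regularity (excess decay) or a LOCAL argument
whose only input is the state of the star's immediate environment.  The cut below separates exactly the configurations where the local argument
has teeth from those where it has none.

(β) THE CUT (exhaustion by `em` on the collar, PROVED; the parent is recovered EXACTLY: `tameWindowPG_iff_calmCollarWindow_and_cloud`).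
The COLLAR of a site `x` is `collar S x ℓ := S ∩ (ball x ℓ ∖ closedBall x 8)` — the sites whose `4`-stars do not meet the closed `4`-star of `x`
(`four_lt_dist_of_mem_collar`; inner radius `8 = 2·4` is forced, outer radius `ℓ` is a literal).
* SPECIAL = ISOLATED hot stars: the collar is `(ϑc, ωc)`-COHERENT to the chart lattice (`IsCoherentOn`, part UD: every collar star `ϑc`-close to
  a chart star rotated by `≤ ωc` from the chart orientation, `ϑc ≪ ϑ` deep in the perturbative basin).  Excluded by [I_w] `CalmCollarWindowPG`
  ([T]'s binders, conclusion only at sites with a calm collar; WEAKER than [T], PROVED), which in turn follows from the LOCAL statement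
  [I] `CalmCollarPG` — NO window, NO registration, NO `η`, NO `R`: «in a θ-good e⋆-GSC door set, a site whose collar is `(ϑc, ωc)`-coherent to an
  equilibrium chart lattice has a `ϑ`-tame star» (`calmCollarWindowPG_of_calmCollarPG`, PROVED).  Mechanism (named, not typed): the
  grand-canonical exchange of the patch `S ∩ ball x ((8+ℓ)/2)` for the chart patch fitted to the calm collar (cost = the feathering of the
  collar's OWN deviation field, at worst `≲ (ϑc² + ωc²)·#collar`, plus `r⁻⁶` tails) against a FINITE-PATCH ENERGY GAP (every clean single-site-Nash
  patch with calm collar and hot centre exceeds the chart patch by `c_hot > cost`: a finite-dimensional, computer-certifiable inequality — e⋆-GSC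
  SELECTS the Cauchy–Born-close solution of the patch boundary-value problem, whose local uniqueness is E–Ming / Braun–Schmidt / Ortner–Theil).
  Calmness enters qualitatively: it makes the collar's registration to the chart forced and puts the collar in the linearised regime.
* GENERIC = CLOUDED hot stars: the collar is NOT coherent (a warm, hot or wound star within `ℓ` of `x`).  [T_cl] `CloudTameWindowPG` is [T]
  restricted to them (WEAKER than [T], PROVED): the residual, UNDECIDED, IDEA-NAMED (cloud-SIZE dichotomy: fat clouds by the volume-vs-surface
  e⋆-GSC comparison, thin clouds the open middle) and census-instrumentable ((F0c) «CollarScan»).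
TRADE-OFF typed: [I] weakens and [T_cl] strengthens as `ℓ` grows or `ϑc, ωc` shrink (`CalmCollarPG.mono`, `CloudTameWindowPG.anti`); at `ℓ ≤ 8`
the collar is empty, [T_cl] is vacuous (`cloudTameWindowPG_of_le_eight`) and [I] degenerates to a global tame-Liouville claim — the record literal
is `ℓ = collarRadius = 16`, calm level `ϑc = ωc = calmLevel = 1/2000` (pending calibration by (F0c)/(F0d)); every seam holds for all parameters.
Record literals `(aHi; Λ, θ, s; ϑ) = (1; 2, 1/16, 1/50; tameRadius)`; no literature claim is made by the three Props.
-/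

noncomputable section

open scoped BigOperators
open MeasureTheory Set Metric Filter Topology
open Summit.AtomisticToContinuum.Crystallization.Theorems.ChartedPlanarOrderRigidityDoor (E3 atomsIn)
open Summit.AtomisticToContinuum.Crystallization.Theorems.ChartedPlanarOrderDensityDichotomy (μS IsSep nK nK_nonneg)
open Summit.AtomisticToContinuum.Crystallization.Theorems.ChartedPlanarOrderCleanScaleP (IsCleanP IsDoorSetP)
open Summit.AtomisticToContinuum.Crystallization.Theorems.ChartedPlanarOrderMesoCut (LayeredHom EnvClose)
open Summit.AtomisticToContinuum.Crystallization.Theorems.ChartedPlanarOrderDoorLayered (atomsIn_subset)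
open Summit.AtomisticToContinuum.Crystallization.Theorems.ChartedPlanarOrderDoorLayeredOsc (IsTwoShellAffineGood)
open Literature.Analysis.PDE (finavg ZatorskaGoldstein2005_localGehringLemmaCounting)

namespace Summit.AtomisticToContinuum.Crystallization.Theorems.ChartedZeroExcessLayeredLatticeLiouville

/-! ### YE.1  The collar of a site (the currency of the cut) -/

/-- ★ **`collar S x ℓ`** — the sites of `S` at distance in `(8, ℓ)` from `x`: those whose `4`-stars are disjoint from the closed `4`-star of `x`
(`four_lt_dist_of_mem_collar`).  The ISOLATION of a hot star is read off its collar. [this file, g45] -/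
def collar (S : Set E3) (x : E3) (ℓ : ℝ) : Set E3 := S ∩ (ball x ℓ \ closedBall x 8)

/-- membership in the collar. [this file, g45] -/
theorem mem_collar {S : Set E3} {x p : E3} {ℓ : ℝ} : p ∈ collar S x ℓ ↔ p ∈ S ∧ dist p x < ℓ ∧ 8 < dist p x := by
  simp only [collar, mem_inter_iff, Set.mem_sdiff, mem_ball, mem_closedBall, not_le]

/-- the collar consists of sites. [this file, g45] -/
theorem collar_subset (S : Set E3) (x : E3) (ℓ : ℝ) : collar S x ℓ ⊆ S := fun _ hp => hp.1

/-- the collar grows with the outer radius. [this file, g45] -/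
theorem collar_mono (S : Set E3) (x : E3) {ℓ ℓ' : ℝ} (h : ℓ ≤ ℓ') : collar S x ℓ ⊆ collar S x ℓ' := fun p hp => by
  rw [mem_collar] at hp ⊢
  exact ⟨hp.1, lt_of_lt_of_le hp.2.1 h, hp.2.2⟩

/-- DEGENERATE END: for `ℓ ≤ 8` the collar is empty (then [T_cl] is vacuous and [I] is a global claim — not the intended regime). [this file, g45] -/
theorem collar_eq_empty_of_le {S : Set E3} {x : E3} {ℓ : ℝ} (h : ℓ ≤ 8) : collar S x ℓ = ∅ := by
  ext p
  simp only [mem_collar, mem_empty_iff_false, iff_false, not_and, not_lt]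
  intro _ hpl
  linarith

/-- WHY THE INNER RADIUS IS `8`: a point within `4` of a collar site is more than `4` from the centre — collar stars do not meet the closed `4`-star
of `x`, so a hot core cannot by itself spoil the coherence of a collar star. [this file, g45] -/
theorem four_lt_dist_of_mem_collar {S : Set E3} {x p q : E3} {ℓ : ℝ} (hp : p ∈ collar S x ℓ) (hq : dist q p ≤ 4) : 4 < dist q x := by
  have h8 := (mem_collar.1 hp).2.2
  have ht := dist_triangle p q x
  rw [dist_comm p q] at ht
  linarith

/-- the empty patch is coherent at every tolerance. [this file, g45] -/
theorem isCoherentOn_empty (ϑ₁ ω₁ : ℝ) (S H : Set E3) : IsCoherentOn ϑ₁ ω₁ S H ∅ := by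
  intro x hx
  simp at hx

/-- VACUITY GUARD for the LOCAL statements (no registration at hand): relative to any NONEMPTY model set every star is `ϑ`-tame once `ϑ ≥ 4`
(`U := 1`, `g :=` a constant) — the content of [I] is in small `ϑ`. [this file, g45] -/
theorem isTameStar_of_four_le {ϑ : ℝ} (hϑ : 4 ≤ ϑ) {S H : Set E3} (hH : H.Nonempty) (x : E3) : IsTameStar ϑ S H x := by
  obtain ⟨h₀, hh₀⟩ := hH
  refine ⟨LinearIsometryEquiv.refl ℝ E3, fun _ => h₀, det_refl_E3_eq_one, fun _ _ => hh₀, fun p _ hpx => ?_⟩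
  have h : dist ((LinearIsometryEquiv.refl ℝ E3) (p - x)) (h₀ - h₀) = dist p x := by simp [dist_eq_norm]
  rw [h]
  exact hpx.trans hϑ

/-! ### YE.2  The cut beneath [T]: [I] (local: calm collar ⇒ tame centre), its window form [I_w], and the clouded residual [T_cl] -/

/-- ★★ **[I] «CalmCollarPG ϑ ϑc ωc ℓ aHi Λ θ s» — A CALM COLLAR FORCES A TAME CENTRE** (the SPECIAL side, LOCAL form).  For every θ-good
`aHi`-GSC door set `S` (`IsDoorSetPG`: two-shell clean, single-site Nash, charted, e⋆-GSC), every equilibrium `s`-chart `(L, w)` at scale `a`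
(`IsEquilChart`) and every site `x ∈ S`: if the collar `collar S x ℓ` is `(ϑc, ωc)`-COHERENT to the chart lattice `LayeredHom L w` (part UD:
every collar star `ϑc`-close to a chart star rotated `≤ ωc` from the chart orientation), then the star of `x` is `ϑ`-TAME.  NO window, NO
registration, NO flatness level, NO radius: the statement sees only `S ∩ ball x ℓ` and the GSC/Nash axioms — the ISOLATED hot star is a
finite, local object.  INCOMPARABLE with [T] (local hypothesis, global reach); implies the window form [I_w] (`calmCollarWindowPG_of_calmCollarPG`,
PROVED); trivial for `ϑ ≥ 4` (`isTameStar_of_four_le`) and degenerate for `ℓ ≤ 8` (empty collar: a global tame-Liouville claim, NOT intended);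
antitone in `ℓ`, monotone in `ϑc, ωc` (`CalmCollarPG.mono`).  MECHANISM-NAMED · GSC-priced · LOCAL · UNDECIDED(stated tests: (F0c) «CollarScan» —
on the generated defected-but-θ-good relaxed configurations of (F0b) and the 54 windows of TAG 174 (a⁗), per site the Kabsch star misfit `m(x)` to the
chart catalogue and the collar profile `(m_c, t_c)(x) := max over collar sites of (misfit, tilt angle to the chart)`; prediction: the quadrant
`{m(x) ≥ ϑ, m_c ≤ ϑc, t_c ≤ ωc}` is EMPTY on configurations passing the finite e⋆-replacement proxy; kill sign: an isolated hot star in a calm collar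
passing the proxy — and (F0d) «PatchGap», offline and certifiable: an interval lower bound `c_hot` for `E(patch) − E(chart patch)` over clean
single-site-Nash patches in `ball 0 ℓ` with `(ϑc, ωc)`-calm collar and `ϑ`-hot centre, to be compared with the exchange cost — the
feathering of the collar's own deviation field, at worst `C·(ϑc² + ωc²)·#collar`, plus `r⁻⁶` tails) · ATTACKABLE·L (computer-assisted): e⋆-GSC
applied to ONE exchange — the patch inside the collar replaced by the chart patch fitted to the collar — selects, among clean Nash solutions of the
patch boundary-value problem with calm data, the Cauchy–Born-close one (locally unique: E–Ming, Braun–Schmidt, Ortner–Theil), which is tame; the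
finite-patch energy gap excludes every other.  Calmness enters qualitatively (forced registration of the collar, linearised regime), so the
literals only need to sit inside the perturbative basin of the chart.
Why it might fail: (a) the literals — if `ϑc` is not deep in the basin relative to `ϑ` the exchange has no force (a smooth mesoscale strain wave has
hot centre and almost-hot collar), hence `ϑc = ωc = 1/2000 ≪ ϑ = 1/20`; conversely an anomaly whose own near field still exceeds `ϑc` at radius `8`
(a twin platelet bounded by a partial loop) is NOT isolated in this sense and falls to [T_cl]; (b) a second clean Nash patch solution with calm
collar, hot centre and energy within the feathering cost of the chart patch (a near-degenerate localized mode) — none known for Lennard-Jones close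
packings, none seen in the census, no theorem excludes it; (c) the `r⁻⁶` tails across a collar of width `ℓ − 8 ≥ 8` must be dominated by `c_hot`.
Sources: E–Ming, Arch. Ration. Mech. Anal. 183 (2007) 241 (local uniqueness/stability of the atomistic BVP near Cauchy–Born); Braun–Schmidt,
arXiv 1604.00197, pp. 2–3 (existence and convergence for the atomistic boundary-value problem); Ortner–Theil, Arch. Ration. Mech. Anal. 207 (2013)
1025; Olson–Ortner, arXiv 1608.08930, p. 9 (atomistic stability ⇒ Cauchy–Born stability, locality of defects); Ehrlacher–Ortner–Shapeev, Arch.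
Ration. Mech. Anal. 222 (2016) 1217 (far fields of localized lattice anomalies); Knops–Payne, Uniqueness Theorems in Linear Elasticity (1971) p. 5
(the continuum ancestor); Theil, Comm. Math. Phys. 262 (2006) 209; this tree: `IsEStarGSC` (the exchange axiom), `UniformTameStability` (part TP),
[T] (part UC), `IsCoherentOn` (part UD); census TAG 174 (a⁗), (F0)/(F0b) of NODE-g43. [this file, g45] -/
def CalmCollarPG (ϑ ϑc ωc ℓ aHi Λ θ s : ℝ) : Prop :=
  ∀ δ : ℝ, 0 < δ → ∀ a : ℝ, 0 < a →
    ∀ S : Set E3, IsDoorSetPG aHi δ S → (∀ q ∈ S, IsTwoShellAffineGood θ S q) →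
      ∀ (L : E3 ≃L[ℝ] E3) (w : ℤ → E3), IsEquilChart a s Λ L w →
        ∀ x ∈ S, IsCoherentOn ϑc ωc S (LayeredHom (L : E3 →L[ℝ] E3) w) (collar S x ℓ) →
          IsTameStar ϑ S (LayeredHom (L : E3 →L[ℝ] E3) w) x

/-- ★ **[I_w] «CalmCollarWindowPG ϑ ϑc ωc ℓ aHi Λ θ s» — [T] AT THE ISOLATED SITES** (the SPECIAL side, window form): verbatim [T] `TameWindowPG ϑ`
(part UC) with the conclusion restricted to the sites `x ∈ win 9R` whose collar is `(ϑc, ωc)`-coherent to the chart lattice.  WEAKER than [T]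
(`calmCollarWindowPG_of_tameWindowPG`, PROVED); implied by the local statement [I] (`calmCollarWindowPG_of_calmCollarPG`, PROVED — the window data
`η, R, Ψ, K₀` are simply not used); with [T_cl] it gives [T] back EXACTLY (`tameWindowPG_iff_calmCollarWindow_and_cloud`, PROVED).  Bookkeeping form of
the special side; status and tests as [I].
Why it might fail: only if [I] fails AND the window data do not rescue it — scenario (b) of [I] realised inside a near-flat fat GSC window.
Sources: as [I]; part UC ([T]). [this file, g45] -/
def CalmCollarWindowPG (ϑ ϑc ωc ℓ aHi Λ θ s : ℝ) : Prop :=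
  ∀ δ : ℝ, 0 < δ → ∀ a : ℝ, 0 < a → ∀ Cg : ℝ, 1 ≤ Cg → ∀ K₀ : ℝ, 0 < K₀ → ∃ η₁ : ℝ, 0 < η₁ ∧ ∃ R₁ : ℝ, 0 < R₁ ∧
    ∀ S : Set E3, IsDoorSetPG aHi δ S → (∀ q ∈ S, IsTwoShellAffineGood θ S q) →
      ∀ η : ℝ, 0 < η → η ≤ η₁ → ∀ R : ℝ, R₁ ≤ R →
        ∀ (L : E3 ≃L[ℝ] E3) (w : ℤ → E3), IsEquilChart a s Λ L w →
          ∀ Ψ : E3 → E3, IsGlobalReg Cg η R S (LayeredHom (L : E3 →L[ℝ] E3) w) Ψ →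
            K₀ ≤ η * nK (atomsIn (μS S) 0 R) →
              ∀ x ∈ atomsIn (μS S) 0 (9 * R), IsCoherentOn ϑc ωc S (LayeredHom (L : E3 →L[ℝ] E3) w) (collar S x ℓ) →
                IsTameStar ϑ S (LayeredHom (L : E3 →L[ℝ] E3) w) x

/-- ★★ **[T_cl] «CloudTameWindowPG ϑ ϑc ωc ℓ aHi Λ θ s» — NEAR-FLAT FAT GSC DOOR WINDOWS HAVE NO CLOUDED `ϑ`-HOT STAR** (the GENERIC side = the
residual): verbatim [T] `TameWindowPG ϑ` with the conclusion restricted to the sites `x ∈ win 9R` whose collar is NOT `(ϑc, ωc)`-coherent to the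
chart lattice — a hot star accompanied, within distance `ℓ`, by a warm (misfit `> ϑc`), hot, or wound (tilt `> ωc`) star must still not occur.
WEAKER than [T] (`cloudTameWindowPG_of_tameWindowPG`, PROVED; strictly at currency level: an isolated hot star in a calm collar violates [T] and is
not addressed here); antitone in `ϑc, ωc`, monotone in `ℓ` (`CloudTameWindowPG.anti`); vacuous for `ℓ ≤ 8` (`cloudTameWindowPG_of_le_eight`).  For
`η ≤ η₁ ≪ ϑc²` most collars of a near-flat window are calm (Chebyshev on the registration budget), so [T_cl] speaks only of the sites where misfit
CONCENTRATES at scale `ℓ` around a hot star: the HOT CLOUD.  NEW · GSC-priced · UNDECIDED(stated test: (F0c) «CollarScan», quadrant `{m(x) ≥ ϑ,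
collar not calm}` on near-flat windows; kill sign: a near-flat fat window passing the e⋆-replacement proxy with a hot cloud) · INSTRUMENTABLE ·
IDEA-NAMED (cloud-SIZE dichotomy: a FAT cloud — misfit density `≳ ϑc²` sustained on a ball of radius `D ≫ 1` — is excluded by the volume-vs-surface
e⋆-GSC comparison with the relaxed chart continuation, gain `≳ ϑc²·D³` against an incoherent-interface cost `≲ D²` (Cauchy–Born stability of the
equilibrium chart, `UniformTameStability`); THIN clouds (filaments, platelets, force-dipole strings) are the open middle, where the e⋆-GSC exchange must
be organised along the cloud).
Why it might fail: as [T] — a coherent, defect-free, self-equilibrated anomaly CLOUD (single-site Nash, two-shell clean, charted) that no finite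
grand-canonical replacement at `μ = e⋆` improves; none known for Lennard-Jones fcc/hcp, none seen in the census, no theorem excludes it.
Sources: as [T] (part UC): Ehrlacher–Ortner–Shapeev, Arch. Ration. Mech. Anal. 222 (2016) 1217; Theil, Comm. Math. Phys. 262 (2006) 209; Flatley–Theil,
arXiv 1407.0692; E–Ming, Arch. Ration. Mech. Anal. 183 (2007) 241; this tree: [T] `TameWindowPG`, `UniformTameStability` (part TP); census TAG 174 (a⁗),
(F0b). [this file, g45] -/
def CloudTameWindowPG (ϑ ϑc ωc ℓ aHi Λ θ s : ℝ) : Prop :=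
  ∀ δ : ℝ, 0 < δ → ∀ a : ℝ, 0 < a → ∀ Cg : ℝ, 1 ≤ Cg → ∀ K₀ : ℝ, 0 < K₀ → ∃ η₁ : ℝ, 0 < η₁ ∧ ∃ R₁ : ℝ, 0 < R₁ ∧
    ∀ S : Set E3, IsDoorSetPG aHi δ S → (∀ q ∈ S, IsTwoShellAffineGood θ S q) →
      ∀ η : ℝ, 0 < η → η ≤ η₁ → ∀ R : ℝ, R₁ ≤ R →
        ∀ (L : E3 ≃L[ℝ] E3) (w : ℤ → E3), IsEquilChart a s Λ L w →
          ∀ Ψ : E3 → E3, IsGlobalReg Cg η R S (LayeredHom (L : E3 →L[ℝ] E3) w) Ψ →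
            K₀ ≤ η * nK (atomsIn (μS S) 0 R) →
              ∀ x ∈ atomsIn (μS S) 0 (9 * R), ¬ IsCoherentOn ϑc ωc S (LayeredHom (L : E3 →L[ℝ] E3) w) (collar S x ℓ) →
                IsTameStar ϑ S (LayeredHom (L : E3 →L[ℝ] E3) w) x

/-- **[I] ⇒ [I_w] (PROVED)** — the local statement gives the window form (the window data are not used; `win 9R ⊆ S`). [this file, g45] -/
theorem calmCollarWindowPG_of_calmCollarPG {ϑ ϑc ωc ℓ aHi Λ θ s : ℝ} (h : CalmCollarPG ϑ ϑc ωc ℓ aHi Λ θ s) :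
    CalmCollarWindowPG ϑ ϑc ωc ℓ aHi Λ θ s := by
  intro δ hδ a ha Cg _ K₀ _
  exact ⟨1, one_pos, 1, one_pos, fun S hS hgood η _ _ R _ L w hLw Ψ _ _ x hx hc =>
    h δ hδ a ha S hS hgood L w hLw x (atomsIn_subset S (9 * R) hx) hc⟩

/-- **[T] ⇒ [I_w] (PROVED)** — the special side is WEAKER than [T] (the collar hypothesis unused). [this file, g45] -/
theorem calmCollarWindowPG_of_tameWindowPG {ϑ ϑc ωc ℓ aHi Λ θ s : ℝ} (h : TameWindowPG ϑ aHi Λ θ s) :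
    CalmCollarWindowPG ϑ ϑc ωc ℓ aHi Λ θ s := by
  intro δ hδ a ha Cg hCg K₀ hK₀
  obtain ⟨η₁, hη₁, R₁, hR₁, h1⟩ := h δ hδ a ha Cg hCg K₀ hK₀
  exact ⟨η₁, hη₁, R₁, hR₁, fun S hS hgood η hη hηle R hR L w hLw Ψ hΨ hfat x hx _ =>
    h1 S hS hgood η hη hηle R hR L w hLw Ψ hΨ hfat x hx⟩

/-- **[T] ⇒ [T_cl] (PROVED)** — the residual is WEAKER than [T] (the non-coherence hypothesis unused). [this file, g45] -/
theorem cloudTameWindowPG_of_tameWindowPG {ϑ ϑc ωc ℓ aHi Λ θ s : ℝ} (h : TameWindowPG ϑ aHi Λ θ s) :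
    CloudTameWindowPG ϑ ϑc ωc ℓ aHi Λ θ s := by
  intro δ hδ a ha Cg hCg K₀ hK₀
  obtain ⟨η₁, hη₁, R₁, hR₁, h1⟩ := h δ hδ a ha Cg hCg K₀ hK₀
  exact ⟨η₁, hη₁, R₁, hR₁, fun S hS hgood η hη hηle R hR L w hLw Ψ hΨ hfat x hx _ =>
    h1 S hS hgood η hη hηle R hR L w hLw Ψ hΨ hfat x hx⟩

/-- ★★★ **SEAM (PROVED): `[I_w] ∧ [T_cl] ⇒ [T]`** — the dichotomy is exhaustive: at each site of `win 9R` the collar is coherent or not (`em`);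
thresholds `η₁ := min`, `R₁ := max`.  The literals `(ϑc, ωc, ℓ)` are SHARED by the two sides — nothing is matched across the seam. [this file, g45] -/
theorem tameWindowPG_of_calmCollarWindow_of_cloud {ϑ ϑc ωc ℓ aHi Λ θ s : ℝ} (hI : CalmCollarWindowPG ϑ ϑc ωc ℓ aHi Λ θ s)
    (hC : CloudTameWindowPG ϑ ϑc ωc ℓ aHi Λ θ s) : TameWindowPG ϑ aHi Λ θ s := by
  intro δ hδ a ha Cg hCg K₀ hK₀
  obtain ⟨η₁, hη₁, R₁, hR₁, h1⟩ := hI δ hδ a ha Cg hCg K₀ hK₀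
  obtain ⟨η₁', hη₁', R₁', hR₁', h2⟩ := hC δ hδ a ha Cg hCg K₀ hK₀
  refine ⟨min η₁ η₁', lt_min hη₁ hη₁', max R₁ R₁', lt_max_of_lt_left hR₁, ?_⟩
  intro S hS hgood η hη hηle R hR L w hLw Ψ hΨ hfat x hx
  by_cases hc : IsCoherentOn ϑc ωc S (LayeredHom (L : E3 →L[ℝ] E3) w) (collar S x ℓ)
  · exact h1 S hS hgood η hη (hηle.trans (min_le_left _ _)) R ((le_max_left _ _).trans hR) L w hLw Ψ hΨ hfat x hx hc
  · exact h2 S hS hgood η hη (hηle.trans (min_le_right _ _)) R ((le_max_right _ _).trans hR) L w hLw Ψ hΨ hfat x hx hc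

/-- ★★★ **THE PARTITION (PROVED): `[T] ⟺ [I_w] ∧ [T_cl]`** at every value of the literals `(ϑc, ωc, ℓ)`. [this file, g45] -/
theorem tameWindowPG_iff_calmCollarWindow_and_cloud (ϑ ϑc ωc ℓ aHi Λ θ s : ℝ) :
    TameWindowPG ϑ aHi Λ θ s ↔ CalmCollarWindowPG ϑ ϑc ωc ℓ aHi Λ θ s ∧ CloudTameWindowPG ϑ ϑc ωc ℓ aHi Λ θ s :=
  ⟨fun h => ⟨calmCollarWindowPG_of_tameWindowPG h, cloudTameWindowPG_of_tameWindowPG h⟩,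
    fun h => tameWindowPG_of_calmCollarWindow_of_cloud h.1 h.2⟩

/-- ★★★ **SEAM (PROVED): `[I] ∧ [T_cl] ⇒ [T]`** — the local statement and the clouded residual give the hot-star exclusion. [this file, g45] -/
theorem tameWindowPG_of_calmCollar_of_cloud {ϑ ϑc ωc ℓ aHi Λ θ s : ℝ} (hI : CalmCollarPG ϑ ϑc ωc ℓ aHi Λ θ s)
    (hC : CloudTameWindowPG ϑ ϑc ωc ℓ aHi Λ θ s) : TameWindowPG ϑ aHi Λ θ s :=
  tameWindowPG_of_calmCollarWindow_of_cloud (calmCollarWindowPG_of_calmCollarPG hI) hC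

/-! ### YE.3  The trade-off between the two sides, and the degenerate end -/

/-- TRADE-OFF, special side: [I] is monotone in `ϑ`, ANTITONE in the outer radius `ℓ` and MONOTONE in the calm levels `ϑc, ωc` — a larger collar or
a deeper calm level is a stronger hypothesis, hence a weaker statement. [this file, g45] -/
theorem CalmCollarPG.mono {ϑ ϑ' ϑc ϑc' ωc ωc' ℓ ℓ' aHi Λ θ s : ℝ} (hϑ : ϑ ≤ ϑ') (hϑc : ϑc' ≤ ϑc) (hωc : ωc' ≤ ωc) (hℓ : ℓ ≤ ℓ')
    (h : CalmCollarPG ϑ ϑc ωc ℓ aHi Λ θ s) : CalmCollarPG ϑ' ϑc' ωc' ℓ' aHi Λ θ s :=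
  fun δ hδ a ha S hS hgood L w hLw x hx hc =>
    (h δ hδ a ha S hS hgood L w hLw x hx (hc.mono hϑc hωc (collar_mono S x hℓ))).mono hϑ

/-- TRADE-OFF, generic side: [T_cl] is monotone in `ϑ`, MONOTONE in `ℓ`-shrinking and ANTITONE in the calm levels — exactly opposite to [I]: moving
the literals shifts content between the two sides, never out of the pair (`tameWindowPG_iff_calmCollarWindow_and_cloud`). [this file, g45] -/
theorem CloudTameWindowPG.anti {ϑ ϑ' ϑc ϑc' ωc ωc' ℓ ℓ' aHi Λ θ s : ℝ} (hϑ : ϑ ≤ ϑ') (hϑc : ϑc ≤ ϑc') (hωc : ωc ≤ ωc') (hℓ : ℓ' ≤ ℓ)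
    (h : CloudTameWindowPG ϑ ϑc ωc ℓ aHi Λ θ s) : CloudTameWindowPG ϑ' ϑc' ωc' ℓ' aHi Λ θ s := by
  intro δ hδ a ha Cg hCg K₀ hK₀
  obtain ⟨η₁, hη₁, R₁, hR₁, h1⟩ := h δ hδ a ha Cg hCg K₀ hK₀
  exact ⟨η₁, hη₁, R₁, hR₁, fun S hS hgood η hη hηle R hR L w hLw Ψ hΨ hfat x hx hnc =>
    (h1 S hS hgood η hη hηle R hR L w hLw Ψ hΨ hfat x hx fun hc => hnc (hc.mono hϑc hωc (collar_mono S x hℓ))).mono hϑ⟩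

/-- DEGENERATE END (vacuity guard): for `ℓ ≤ 8` the collar is empty, hence coherent, and [T_cl] holds vacuously — all of [T] then sits in [I_w].
The record literal `ℓ = 16` keeps both sides populated. [this file, g45] -/
theorem cloudTameWindowPG_of_le_eight {ϑ ϑc ωc ℓ aHi Λ θ s : ℝ} (hℓ : ℓ ≤ 8) : CloudTameWindowPG ϑ ϑc ωc ℓ aHi Λ θ s := by
  intro δ _ a _ Cg _ K₀ _
  refine ⟨1, one_pos, 1, one_pos, fun S _ _ η _ _ R _ L w _ Ψ _ _ x _ hnc => ?_⟩
  exact absurd (by rw [collar_eq_empty_of_le hℓ]; exact isCoherentOn_empty _ _ _ _) hnc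

/-- DICTIONARY: on any set of sites all of whose collars are calm, [I] gives tameness (how the local statement is consumed). [this file, g45] -/
theorem isTameOn_of_calmCollarPG {ϑ ϑc ωc ℓ aHi Λ θ s : ℝ} (h : CalmCollarPG ϑ ϑc ωc ℓ aHi Λ θ s) {δ a : ℝ} (hδ : 0 < δ) (ha : 0 < a)
    {S : Set E3} (hS : IsDoorSetPG aHi δ S) (hgood : ∀ q ∈ S, IsTwoShellAffineGood θ S q) {L : E3 ≃L[ℝ] E3} {w : ℤ → E3}
    (hLw : IsEquilChart a s Λ L w) {K : Set E3} (hK : K ⊆ S)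
    (hcalm : ∀ x ∈ K, IsCoherentOn ϑc ωc S (LayeredHom (L : E3 →L[ℝ] E3) w) (collar S x ℓ)) :
    IsTameOn ϑ S (LayeredHom (L : E3 →L[ℝ] E3) w) K :=
  fun x hx => h δ hδ a ha S hS hgood L w hLw x (hK hx) (hcalm x hx)

/-! ### YE.4  The line down to [C] and (M), and the record literals -/

/-- the CALM LEVEL of record (misfit and tilt tolerance of a calm collar): `1/2000`, deep in the perturbative basin below `ϑ = tameRadius = 1/20`;
pending calibration by (F0c)/(F0d). [this file, g45] -/
def calmLevel : ℝ := 1 / 2000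

/-- the COLLAR RADIUS of record: `16` (collar width `8`, twice the star radius); pending calibration by (F0c)/(F0d). [this file, g45] -/
def collarRadius : ℝ := 16

/-- ★★★ **COROLLARY (PROVED): the calm-collar line down to [C]** — `[I] ∧ [T_cl] ∧ [KS] ∧ [W] ∧ [CC°_W] ⇒ [C] RigidCaccioppoliPG`. [this file, g45] -/
theorem rigidCaccioppoliPG_of_calmCollar_line {ϑ ϑc ωc ℓ aHi Λ θ s : ℝ} (hI : CalmCollarPG ϑ ϑc ωc ℓ aHi Λ θ s)
    (hCl : CloudTameWindowPG ϑ ϑc ωc ℓ aHi Λ θ s) (hKS : KornSobolevPoincareP aHi θ) (hW : CoherentWindowPG ϑ aHi Λ θ s)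
    (hC : CoherentGscCaccioppoliPG ϑ aHi Λ θ s) : RigidCaccioppoliPG aHi Λ θ s :=
  rigidCaccioppoliPG_of_coherent_line (tameWindowPG_of_calmCollar_of_cloud hI hCl) hKS hW hC

/-- ★★★ **COROLLARY (PROVED): the calm-collar line down to (M)** — with the Gehring leaf (part UB): `[I] ∧ [T_cl] ∧ [KS] ∧ [W] ∧ [CC°_W] ∧ leaf ⇒
StrainNonConcentrationPG` (`aHi ≤ 8/7`). [this file, g45] -/
theorem strainNonConcentrationPG_of_calmCollar_line {ϑ ϑc ωc ℓ aHi Λ θ s : ℝ} (haHi : aHi ≤ 8 / 7)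
    (hG : ZatorskaGoldstein2005_localGehringLemmaCounting) (hI : CalmCollarPG ϑ ϑc ωc ℓ aHi Λ θ s)
    (hCl : CloudTameWindowPG ϑ ϑc ωc ℓ aHi Λ θ s) (hKS : KornSobolevPoincareP aHi θ) (hW : CoherentWindowPG ϑ aHi Λ θ s)
    (hC : CoherentGscCaccioppoliPG ϑ aHi Λ θ s) : StrainNonConcentrationPG aHi Λ θ s :=
  strainNonConcentrationPG_of_coherent_line haHi hG (tameWindowPG_of_calmCollar_of_cloud hI hCl) hKS hW hC

/-- Record example at the literals `(aHi; Λ, θ, s; ϑ; ϑc, ωc, ℓ) = (1; 2, 1/16, 1/50; tameRadius; calmLevel, calmLevel, collarRadius)`: the pair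
[I] ∧ [T_cl] replaces [T] in the line of record ([I] ∧ [T_cl] ∧ [KS] ∧ [W] ∧ [CC°_W] ⇒ [C]). -/
example (hI : CalmCollarPG tameRadius calmLevel calmLevel collarRadius 1 2 (1 / 16) (1 / 50))
    (hCl : CloudTameWindowPG tameRadius calmLevel calmLevel collarRadius 1 2 (1 / 16) (1 / 50)) (hKS : KornSobolevPoincareP 1 (1 / 16))
    (hW : CoherentWindowPG tameRadius 1 2 (1 / 16) (1 / 50)) (hC : CoherentGscCaccioppoliPG tameRadius 1 2 (1 / 16) (1 / 50)) :
    RigidCaccioppoliPG 1 2 (1 / 16) (1 / 50) :=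
  rigidCaccioppoliPG_of_calmCollar_line hI hCl hKS hW hC

/-- Record example at the same literals: the window-form pair recovers [T] itself. -/
example (hI : CalmCollarWindowPG tameRadius calmLevel calmLevel collarRadius 1 2 (1 / 16) (1 / 50))
    (hCl : CloudTameWindowPG tameRadius calmLevel calmLevel collarRadius 1 2 (1 / 16) (1 / 50)) : TameWindowPG tameRadius 1 2 (1 / 16) (1 / 50) :=
  tameWindowPG_of_calmCollarWindow_of_cloud hI hCl

end Summit.AtomisticToContinuum.Crystallization.Theorems.ChartedZeroExcessLayeredLatticeLiouville

end
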